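import Mathlib
import Summits.Ventures.PercRepro2.Defs
import Summits.Ventures.PercRepro2.Harris
import Summits.Ventures.PercRepro2.Graph
import Summits.Ventures.PercRepro2.Events
import Summits.Ventures.PercRepro2.BHKEvents
import Summits.Ventures.PercRepro2.BHKAvoidWeighted
import Summits.Ventures.PercRepro2.PsiPendantLemmas
import Summits.Ventures.PercRepro2.PsiUniSure
import Summits.Ventures.PercRepro2.PsiUniExplored
import Summits.Ventures.PercRepro2.PsiBernstein
import Summits.Ventures.PercRepro2.PsiTEdge
import Summits.Ventures.PercRepro2.PsiBernTMark
import Summits.Ventures.PercRepro2.PsiTEdgeMasses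

/-!
# (BERN_f) at the explored `t`-component from (R2-1) and (Ψ₀′) (PercRepro2, p2)

With the eight open-world masses of `PsiTEdgeMasses.lean`, the mixed Bernstein coefficients of the
(Ψ)-slack along the edge `f = (t', y)` at the explored `t`-component read `T₁ = C·Ug¹ + Ug·A′ + B`
and `T₂ = B₁ + B₂ + Ug·(q¹·oHH¹ − aH¹·oH¹) + Ug¹·A′` (P2-G18-BERN.md §3.3, §7.2), and two
inequalities of the CLOSED world close them: **(R2-1)** `aH¹·So + oH¹·Su + oL¹·Su ≤ oHH¹ + oLH¹ + q¹·SS`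
and **(Ψ₀′)** `q¹·oLU¹ ≤ Ug·(oL¹·(q¹ − aH¹) + q¹·oLH¹)`, together with Harris, the avoid-world
cross-cluster bound `bhk_cross_cluster` and the avoid-conditioned same-cluster PA
`bhk_same_cluster_events`: exactly `q¹·T₁ = P₁ + P₂ + P₃ + P₄` and `T₂ = Q₁ + Q₂ + Q₃ + Q₄` with
nonnegative `P`'s and `Q`'s.  So the hypothesis of the frame `psi_slack_nonneg_of_bern_t` is met at
every such instance whose closed world satisfies (R2-1) and (Ψ₀′) — the reduction
(Ψ) ⟸ (BERN_t) ⟸ (R2-1) ∧ (Ψ₀′) of record, in the kernel.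

* `psi_bern_t_of_r21_psi0` — **`0 ≤ T₁ ∧ 0 ≤ T₂` from (R2-1) and (Ψ₀′) at the closed world**.
-/

namespace Summit.Ventures.PercRepro2

section TGeneralThm

variable {V : Type*} [Fintype V] [DecidableEq V] {E : Type*} [Fintype E] [DecidableEq E]
  {R : Type*} [CommRing R] [LinearOrder R] [IsStrictOrderedRing R]

/-- **(BERN_f) at the explored `t`-component from (R2-1) and (Ψ₀′).** With `f = (t', y)` the only
unpinned edge at the explored component (`t' ∈ Λ`, `s, o ∉ Λ`), `𝓤` an up-set, and the closed world
`p[f↦0]` satisfying (R2-1) and (Ψ₀′) (in its own probabilities, with the avoided vertex `y`), the two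
mixed Bernstein coefficients of the (Ψ)-slack along `f` are nonnegative. -/
theorem psi_bern_t_of_r21_psi0 (p : E → R) (hp : IsProbVec p) (ends : E → Sym2 V) (s t t' y o u : V) (f : E)
    (hf : ends f = s(t', y)) (ht' : Conn ends (fun e => decide (p e = 1)) t t')
    (hs : ¬ Conn ends (fun e => decide (p e = 1)) t s)
    (ho : ¬ Conn ends (fun e => decide (p e = 1)) t o) (hpf1 : p f ≠ 1)
    (hpin : ∀ e, e ≠ f → (∃ v ∈ ends e, Conn ends (fun e => decide (p e = 1)) t v) →
      p e = 0 ∨ p e = 1) {𝓤 : Set (Set V)} (h𝓤 : IsUpperSet 𝓤)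
    (hR : prob (Function.update p f 0) (connEvent ends s u ∩ (connEvent ends s y)ᶜ) * prob (Function.update p f 0) (clusterInEvent ends s {W : Set V | o ∈ W}) +
      prob (Function.update p f 0) (clusterInEvent ends s {W : Set V | o ∈ W} ∩ (connEvent ends s y)ᶜ) * prob (Function.update p f 0) (connEvent ends s u) +
      prob (Function.update p f 0) (connEvent ends y o ∩ (connEvent ends s y)ᶜ) * prob (Function.update p f 0) (connEvent ends s u) ≤
      prob (Function.update p f 0) (connEvent ends s u ∩ clusterInEvent ends s {W : Set V | o ∈ W} ∩
        (connEvent ends s y)ᶜ) +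
      prob (Function.update p f 0) (connEvent ends s u ∩ connEvent ends y o ∩ (connEvent ends s y)ᶜ) +
      prob (Function.update p f 0) (connEvent ends s y)ᶜ * prob (Function.update p f 0) (connEvent ends s u ∩ clusterInEvent ends s {W : Set V | o ∈ W}))
    (hP : prob (Function.update p f 0) (connEvent ends s y)ᶜ * prob (Function.update p f 0) (clusterInEvent ends s 𝓤 ∩ connEvent ends y o ∩ (connEvent ends s y)ᶜ) ≤
      prob (Function.update p f 0) (clusterInEvent ends s 𝓤) * (prob (Function.update p f 0) (connEvent ends y o ∩ (connEvent ends s y)ᶜ) * (prob (Function.update p f 0) (connEvent ends s y)ᶜ - prob (Function.update p f 0) (connEvent ends s u ∩ (connEvent ends s y)ᶜ)) +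
        prob (Function.update p f 0) (connEvent ends s y)ᶜ * prob (Function.update p f 0) (connEvent ends s u ∩ connEvent ends y o ∩ (connEvent ends s y)ᶜ))) :
    0 ≤ (((prob (Function.update p f 0) (connEvent ends s t)ᶜ - prob (Function.update p f 0) (connEvent ends s u ∩ (connEvent ends s t)ᶜ)) * prob (Function.update p f 0) (clusterInEvent ends t {W : Set V | o ∈ W} ∩ (connEvent ends s t)ᶜ) +
          prob (Function.update p f 0) (connEvent ends s t)ᶜ * (prob (Function.update p f 0) (connEvent ends s u ∩ clusterInEvent ends t {W : Set V | o ∈ W} ∩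
          (connEvent ends s t)ᶜ) + prob (Function.update p f 0) (connEvent ends s u ∩ clusterInEvent ends s {W : Set V | o ∈ W} ∩
          (connEvent ends s t)ᶜ)) -
          prob (Function.update p f 0) (connEvent ends s u ∩ (connEvent ends s t)ᶜ) * prob (Function.update p f 0) (clusterInEvent ends s {W : Set V | o ∈ W} ∩ (connEvent ends s t)ᶜ)) * prob (Function.update p f 1) (clusterInEvent ends s 𝓤 ∩ (connEvent ends s t)ᶜ) +
        (prob (Function.update p f 0) (clusterInEvent ends s 𝓤 ∩ (connEvent ends s t)ᶜ) * (prob (Function.update p f 0) (clusterInEvent ends t {W : Set V | o ∈ W} ∩ (connEvent ends s t)ᶜ) + prob (Function.update p f 0) (connEvent ends s u ∩ clusterInEvent ends t {W : Set V | o ∈ W} ∩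
          (connEvent ends s t)ᶜ) + prob (Function.update p f 0) (connEvent ends s u ∩ clusterInEvent ends s {W : Set V | o ∈ W} ∩
          (connEvent ends s t)ᶜ)) -
          2 * prob (Function.update p f 0) (clusterInEvent ends s 𝓤 ∩ clusterInEvent ends t {W : Set V | o ∈ W} ∩
          (connEvent ends s t)ᶜ) * prob (Function.update p f 0) (connEvent ends s t)ᶜ) * prob (Function.update p f 1) (connEvent ends s t)ᶜ +
        prob (Function.update p f 0) (clusterInEvent ends s 𝓤 ∩ (connEvent ends s t)ᶜ) * (prob (Function.update p f 0) (connEvent ends s t)ᶜ - prob (Function.update p f 0) (connEvent ends s u ∩ (connEvent ends s t)ᶜ)) * prob (Function.update p f 1) (clusterInEvent ends t {W : Set V | o ∈ W} ∩ (connEvent ends s t)ᶜ) -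
        prob (Function.update p f 0) (clusterInEvent ends s 𝓤 ∩ (connEvent ends s t)ᶜ) * (prob (Function.update p f 0) (clusterInEvent ends t {W : Set V | o ∈ W} ∩ (connEvent ends s t)ᶜ) + prob (Function.update p f 0) (clusterInEvent ends s {W : Set V | o ∈ W} ∩ (connEvent ends s t)ᶜ)) * prob (Function.update p f 1) (connEvent ends s u ∩ (connEvent ends s t)ᶜ) +
        prob (Function.update p f 0) (clusterInEvent ends s 𝓤 ∩ (connEvent ends s t)ᶜ) * prob (Function.update p f 0) (connEvent ends s t)ᶜ * (prob (Function.update p f 1) (connEvent ends s u ∩ clusterInEvent ends t {W : Set V | o ∈ W} ∩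
          (connEvent ends s t)ᶜ) + prob (Function.update p f 1) (connEvent ends s u ∩ clusterInEvent ends s {W : Set V | o ∈ W} ∩
          (connEvent ends s t)ᶜ)) -
        prob (Function.update p f 0) (clusterInEvent ends s 𝓤 ∩ (connEvent ends s t)ᶜ) * prob (Function.update p f 0) (connEvent ends s u ∩ (connEvent ends s t)ᶜ) * prob (Function.update p f 1) (clusterInEvent ends s {W : Set V | o ∈ W} ∩ (connEvent ends s t)ᶜ) -
        prob (Function.update p f 0) (connEvent ends s t)ᶜ * prob (Function.update p f 0) (connEvent ends s t)ᶜ * prob (Function.update p f 1) (clusterInEvent ends s 𝓤 ∩ clusterInEvent ends t {W : Set V | o ∈ W} ∩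
          (connEvent ends s t)ᶜ)) ∧
    0 ≤ (((prob (Function.update p f 1) (connEvent ends s t)ᶜ - prob (Function.update p f 1) (connEvent ends s u ∩ (connEvent ends s t)ᶜ)) * prob (Function.update p f 1) (clusterInEvent ends t {W : Set V | o ∈ W} ∩ (connEvent ends s t)ᶜ) +
          prob (Function.update p f 1) (connEvent ends s t)ᶜ * (prob (Function.update p f 1) (connEvent ends s u ∩ clusterInEvent ends t {W : Set V | o ∈ W} ∩
          (connEvent ends s t)ᶜ) + prob (Function.update p f 1) (connEvent ends s u ∩ clusterInEvent ends s {W : Set V | o ∈ W} ∩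
          (connEvent ends s t)ᶜ)) -
          prob (Function.update p f 1) (connEvent ends s u ∩ (connEvent ends s t)ᶜ) * prob (Function.update p f 1) (clusterInEvent ends s {W : Set V | o ∈ W} ∩ (connEvent ends s t)ᶜ)) * prob (Function.update p f 0) (clusterInEvent ends s 𝓤 ∩ (connEvent ends s t)ᶜ) +
        (prob (Function.update p f 1) (clusterInEvent ends s 𝓤 ∩ (connEvent ends s t)ᶜ) * (prob (Function.update p f 1) (clusterInEvent ends t {W : Set V | o ∈ W} ∩ (connEvent ends s t)ᶜ) + prob (Function.update p f 1) (connEvent ends s u ∩ clusterInEvent ends t {W : Set V | o ∈ W} ∩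
          (connEvent ends s t)ᶜ) + prob (Function.update p f 1) (connEvent ends s u ∩ clusterInEvent ends s {W : Set V | o ∈ W} ∩
          (connEvent ends s t)ᶜ)) -
          2 * prob (Function.update p f 1) (clusterInEvent ends s 𝓤 ∩ clusterInEvent ends t {W : Set V | o ∈ W} ∩
          (connEvent ends s t)ᶜ) * prob (Function.update p f 1) (connEvent ends s t)ᶜ) * prob (Function.update p f 0) (connEvent ends s t)ᶜ +
        prob (Function.update p f 1) (clusterInEvent ends s 𝓤 ∩ (connEvent ends s t)ᶜ) * (prob (Function.update p f 1) (connEvent ends s t)ᶜ - prob (Function.update p f 1) (connEvent ends s u ∩ (connEvent ends s t)ᶜ)) * prob (Function.update p f 0) (clusterInEvent ends t {W : Set V | o ∈ W} ∩ (connEvent ends s t)ᶜ) -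
        prob (Function.update p f 1) (clusterInEvent ends s 𝓤 ∩ (connEvent ends s t)ᶜ) * (prob (Function.update p f 1) (clusterInEvent ends t {W : Set V | o ∈ W} ∩ (connEvent ends s t)ᶜ) + prob (Function.update p f 1) (clusterInEvent ends s {W : Set V | o ∈ W} ∩ (connEvent ends s t)ᶜ)) * prob (Function.update p f 0) (connEvent ends s u ∩ (connEvent ends s t)ᶜ) +
        prob (Function.update p f 1) (clusterInEvent ends s 𝓤 ∩ (connEvent ends s t)ᶜ) * prob (Function.update p f 1) (connEvent ends s t)ᶜ * (prob (Function.update p f 0) (connEvent ends s u ∩ clusterInEvent ends t {W : Set V | o ∈ W} ∩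
          (connEvent ends s t)ᶜ) + prob (Function.update p f 0) (connEvent ends s u ∩ clusterInEvent ends s {W : Set V | o ∈ W} ∩
          (connEvent ends s t)ᶜ)) -
        prob (Function.update p f 1) (clusterInEvent ends s 𝓤 ∩ (connEvent ends s t)ᶜ) * prob (Function.update p f 1) (connEvent ends s u ∩ (connEvent ends s t)ᶜ) * prob (Function.update p f 0) (clusterInEvent ends s {W : Set V | o ∈ W} ∩ (connEvent ends s t)ᶜ) -
        prob (Function.update p f 1) (connEvent ends s t)ᶜ * prob (Function.update p f 1) (connEvent ends s t)ᶜ * prob (Function.update p f 0) (clusterInEvent ends s 𝓤 ∩ clusterInEvent ends t {W : Set V | o ∈ W} ∩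
          (connEvent ends s t)ᶜ)) := by
  have hp0 : IsProbVec (Function.update p f 0) := hp.update f le_rfl zero_le_one
  have hω := tmark_pinned_eq p f hpf1
  have hpin0 : ∀ e, (∃ v ∈ ends e, Conn ends (fun e => decide (Function.update p f 0 e = 1)) t v) →
      Function.update p f 0 e = 0 ∨ Function.update p f 0 e = 1 := by
    intro e he
    rw [hω] at he
    by_cases hef : e = f
    · subst hef
      exact Or.inl (by simp)
    · rw [Function.update_of_ne hef]
      exact hpin e hef he
  have hQ0 : prob (Function.update p f 0) (connEvent ends s t) = 0 := by
    rw [connEvent_comm]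
    exact prob_connEvent_eq_zero_of_explored _ ends hpin0 (by rw [hω]; exact hs)
  have ho0 : prob (Function.update p f 0) (connEvent ends t o) = 0 :=
    prob_connEvent_eq_zero_of_explored _ ends hpin0 (by rw [hω]; exact ho)
  have hq0 : prob (Function.update p f 0) (connEvent ends s t)ᶜ = 1 := by
    rw [prob_compl, hQ0, sub_zero]
  have hoL0 : prob (Function.update p f 0) (clusterInEvent ends t {W : Set V | o ∈ W}) = 0 := by
    rw [clusterInEvent_memFamily_eq_connEvent]; exact ho0
  -- the open world
  have e1 := tgen_q_one p ends s t t' y f hf ht' hs hpf1 hpin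
  have e2 := tgen_oL_one p ends s t t' y o f hf ht' hs hpf1 hpin ho
  have e3 := tgen_oH_one p ends s t t' y o f hf ht' hs hpf1 hpin
  have e4 := tgen_aH_one p ends s t t' y u f hf ht' hs hpf1 hpin
  have e5 := tgen_oLH_one p ends s t t' y o u f hf ht' hs hpf1 hpin ho
  have e6 := tgen_oHH_one p ends s t t' y o u f hf ht' hs hpf1 hpin
  have e7 := tgen_Ug_one p ends s t t' y f hf ht' hs hpf1 hpin 𝓤
  have e8 := tgen_oLU_one p ends s t t' y o f hf ht' hs hpf1 hpin ho 𝓤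
  rw [e1, e2, e3, e4, e5, e6, e7, e8, hq0]
  simp only [prob_inter_compl_of_eq_zero hp0 hQ0]
  rw [prob_inter_eq_zero_of_right hp0 hoL0, prob_inter_eq_zero_of_right hp0 hoL0, hoL0]
  -- the closed-world facts
  have hlow : IsLowerSet (connEvent ends s y)ᶜ := (isUpperSet_connEvent ends s y).compl
  have hUU : IsUpperSet (clusterInEvent ends s 𝓤) := isUpperSet_clusterInEvent ends s h𝓤
  have hAU : IsUpperSet (connEvent ends s u) := isUpperSet_connEvent ends s u
  have hOH : IsUpperSet (clusterInEvent ends s {W : Set V | o ∈ W}) :=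
    isUpperSet_clusterInEvent ends s (isUpperSet_memFamily o)
  -- C ≥ 0 (Harris)
  have hC : prob (Function.update p f 0) (connEvent ends s u) * prob (Function.update p f 0) (clusterInEvent ends s {W : Set V | o ∈ W}) ≤ prob (Function.update p f 0) (connEvent ends s u ∩ clusterInEvent ends s {W : Set V | o ∈ W}) := prob_mul_prob_le_prob_inter hp0 hAU hOH
  -- Ug_a ≤ q_a · Ug (mixed Harris)
  have hUga : prob (Function.update p f 0) (clusterInEvent ends s 𝓤 ∩ (connEvent ends s y)ᶜ) ≤ prob (Function.update p f 0) (connEvent ends s y)ᶜ * prob (Function.update p f 0) (clusterInEvent ends s 𝓤) := by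
    have h := prob_inter_le_prob_mul_prob_of_isLowerSet hp0 hlow hUU
    rw [Set.inter_comm] at h
    exact h
  -- q_a · SS_a ≥ Su_a · So_a (the avoid-conditioned same-cluster PA)
  have hPA : prob (Function.update p f 0) (connEvent ends s u ∩ (connEvent ends s y)ᶜ) * prob (Function.update p f 0) (clusterInEvent ends s {W : Set V | o ∈ W} ∩ (connEvent ends s y)ᶜ) ≤ prob (Function.update p f 0) (connEvent ends s u ∩ clusterInEvent ends s {W : Set V | o ∈ W} ∩
        (connEvent ends s y)ᶜ) * prob (Function.update p f 0) (connEvent ends s y)ᶜ := by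
    have h := bhk_same_cluster_events (Function.update p f 0) hp0 ends s y (isUpperSet_memFamily u)
      (isUpperSet_memFamily o)
    rw [clusterInEvent_memFamily_eq_connEvent ends s u] at h
    exact h
  -- q_a · ℓ_𝓤 ≤ Ug_a · ℓ (the avoid-world cross-cluster bound)
  have hBK : prob (Function.update p f 0) (clusterInEvent ends s 𝓤 ∩ connEvent ends y o ∩ (connEvent ends s y)ᶜ) * prob (Function.update p f 0) (connEvent ends s y)ᶜ ≤ prob (Function.update p f 0) (clusterInEvent ends s 𝓤 ∩ (connEvent ends s y)ᶜ) * prob (Function.update p f 0) (connEvent ends y o ∩ (connEvent ends s y)ᶜ) := by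
    have h := bhk_cross_cluster (Function.update p f 0) hp0 ends s y h𝓤 (isUpperSet_memFamily o)
    rw [clusterInEvent_memFamily_eq_connEvent ends y o] at h
    exact h
  have hqa : 0 ≤ prob (Function.update p f 0) (connEvent ends s y)ᶜ := prob_nonneg hp0 _
  have hUg : 0 ≤ prob (Function.update p f 0) (clusterInEvent ends s 𝓤) := prob_nonneg hp0 _
  have hUgan : 0 ≤ prob (Function.update p f 0) (clusterInEvent ends s 𝓤 ∩ (connEvent ends s y)ᶜ) := prob_nonneg hp0 _
  have hL : 0 ≤ prob (Function.update p f 0) (connEvent ends y o ∩ (connEvent ends s y)ᶜ) := prob_nonneg hp0 _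
  have hLU : 0 ≤ prob (Function.update p f 0) (connEvent ends s u ∩ connEvent ends y o ∩ (connEvent ends s y)ᶜ) := prob_nonneg hp0 _
  have hLUU : 0 ≤ prob (Function.update p f 0) (clusterInEvent ends s 𝓤 ∩ connEvent ends y o ∩ (connEvent ends s y)ᶜ) := prob_nonneg hp0 _
  have hSOA : 0 ≤ prob (Function.update p f 0) (clusterInEvent ends s {W : Set V | o ∈ W} ∩ (connEvent ends s y)ᶜ) := prob_nonneg hp0 _
  have hSUA : 0 ≤ prob (Function.update p f 0) (connEvent ends s u ∩ (connEvent ends s y)ᶜ) := prob_nonneg hp0 _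
  have hSSA : 0 ≤ prob (Function.update p f 0) (connEvent ends s u ∩ clusterInEvent ends s {W : Set V | o ∈ W} ∩
        (connEvent ends s y)ᶜ) := prob_nonneg hp0 _
  constructor
  · -- q_a · T₁ ≥ 0, then divide
    rcases hqa.lt_or_eq with hqpos | hq0'
    · have P1 := mul_nonneg (mul_nonneg hqa hUg) (sub_nonneg.2 hR)
      have P2 := mul_nonneg (sub_nonneg.2 hUga) hL
      have P3 := sub_nonneg.2 hBK
      have P4 := mul_nonneg (mul_nonneg hqa hUgan) (sub_nonneg.2 hC)
      refine nonneg_of_mul_nonneg_right ?_ hqpos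
      linarith [P1, P2, P3, P4]
    · have hq : prob (Function.update p f 0) (connEvent ends s y)ᶜ = 0 := hq0'.symm
      have zmono : ∀ A : Set (Config E), prob (Function.update p f 0) (A ∩ (connEvent ends s y)ᶜ) = 0 := by
        intro A
        have h := prob_mono hp0 (Set.inter_subset_right : A ∩ (connEvent ends s y)ᶜ ⊆ (connEvent ends s y)ᶜ)
        rw [hq] at h
        exact le_antisymm h (prob_nonneg hp0 _)
      rw [hq, zmono, zmono, zmono, zmono, zmono, zmono, zmono]
      simp
  · have Q1 := sub_nonneg.2 hP
    have Q2 := mul_nonneg hUgan (sub_nonneg.2 hR)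
    have Q3 := sub_nonneg.2 hBK
    have Q4 := mul_nonneg hUg (sub_nonneg.2 hPA)
    linarith [Q1, Q2, Q3, Q4]

end TGeneralThm

end Summit.Ventures.PercRepro2
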